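import Summits.KontsevichZagierPeriods.Zeta5Search.Barrier.ConeGammaTorus

/-!
# ζ(5) search — BARRIER: the REFLECTION identity of the saving exponent (`N_a(1−u) = −min_σ T_σ(u)`)

HONEST FRAMING (cell `pub-zeta5`): systematic search; no irrationality claim unless kernel-certified. MODEL objects under
Brown–Zudilin's (28)+(30) accounting ([BZ22] = arXiv:2210.03391); nothing here is a statement about `ζ(5)`; records in print
UNMOVED. Theory seat cert-2 (drafted g18 for `RIDGE-PHI-DESIGN.md` §2(a); filed g19 on the lead's line of 2026-08-23T13:25Z);
imports `ConeGammaTorus` only. For an INTEGER parameter vector the orbit `u ↦ u·s(a)` has period 1 and the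
second half of a period is the mirror image of the first: off the walls `⌊h(1−u)⌋ = h − 1 − ⌊hu⌋` for every form, and since
`Σ_{i∈F} φ_i` is `S₇`-invariant the torus TERM flips sign, `T_σ(1−u) = −T_σ(u)`; hence the saving exponent on a mirrored gap is
MINUS THE MINIMUM over `σ` on the original gap (not the maximum: on BZ's record ray `N(1−u) = N(u)` on only 22 of 102 gaps).
Use: a gap table for `(0, ½)` with max- AND min-certificates determines the whole period (halves floor checks and table text).

* `torusTerm_intVec_sub` — `torusTerm (ζ − θ) σ = −torusTerm θ σ` when the pair forms of `ζ` are integers and no form of `θ` is an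
  integer; `torusN_intVec_sub` — `torusN (ζ − θ) = −inf_σ torusTerm θ σ`;
* **`savingN_one_sub`** — for `a` in the closed box with integer forms and `u` off the walls (`u·h_k(a) ∉ ℤ` for all `k`):
  `savingN a (1 − u) = −inf_σ torusTerm (u • sParam a) σ`.
-/

noncomputable section

open Finset

namespace Summit.KontsevichZagierPeriods.Zeta5Search.Barrier.ConeGamma

/-- `⌊z − x⌋ = z − 1 − ⌊x⌋` for an integer `z` and a non-integer `x`. -/
theorem floor_int_sub_of_fract_ne_zero {x : ℝ} (hx : Int.fract x ≠ 0) (z : ℤ) : ⌊(z : ℝ) - x⌋ = z - 1 - ⌊x⌋ := by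
  rw [Int.floor_eq_iff]
  have h1 := Int.fract_nonneg x
  have h2 := Int.fract_lt_one x
  have h3 : 0 < Int.fract x := lt_of_le_of_ne h1 (Ne.symm hx)
  rw [Int.fract] at h1 h2 h3
  push_cast
  constructor <;> linarith

/-- **The torus term flips sign under reflection in an integer point**: if every pair form of `ζ` is an integer and no form
of `θ` is an integer, `torusTerm (ζ − θ) σ = −torusTerm θ σ`. -/
theorem torusTerm_intVec_sub {θ ζ : Fin 8 → ℝ} (hζ : ∀ k, ∃ z : ℤ, phiForm ζ k = z)
    (hθ : ∀ k, Int.fract (phiForm θ k) ≠ 0) (σ : Equiv.Perm (Fin 7)) :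
    torusTerm (ζ - θ) σ = -torusTerm θ σ := by
  -- forms of a permuted vector are forms of the vector at permuted pairs, so they are integers / non-integers too
  have hζσ : ∀ k, ∃ z : ℤ, phiForm (permS σ ζ) k = z := by
    intro k
    rw [phiForm_permS]
    exact pairInt_of_phiForm_int hζ _ _ ((liftPerm σ).injective.ne (fstIdx_ne_sndIdx k))
  have hθσ : ∀ k, Int.fract (phiForm (permS σ θ) k) ≠ 0 := by
    intro k
    rw [phiForm_permS]
    have hne := (liftPerm σ).injective.ne (fstIdx_ne_sndIdx k)
    rcases lt_or_gt_of_ne hne with h | h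
    · rw [pairForm_eq_phiForm_idxOf θ h]; exact hθ _
    · rw [pairForm_comm, pairForm_eq_phiForm_idxOf θ h]; exact hθ _
  have hsub : ∀ (ξ η : Fin 8 → ℝ) (k : Fin 28), phiForm (ξ - η) k = phiForm ξ k - phiForm η k := by
    intro ξ η k
    have := phiForm_add (ξ - η) η k
    rw [sub_add_cancel] at this
    linarith
  have hperm : permS σ (ζ - θ) = permS σ ζ - permS σ θ := by
    ext i; simp [permS_apply]
  -- termwise: ⌊φ_k(ζ − θ)⌋ = φ_k(ζ) − 1 − ⌊φ_k θ⌋, and the same after `σ`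
  have hk : ∀ k, (⌊phiForm (ζ - θ) k⌋ : ℝ) = phiForm ζ k - 1 - ⌊phiForm θ k⌋ := by
    intro k
    obtain ⟨z, hz⟩ := hζ k
    rw [hsub, hz, floor_int_sub_of_fract_ne_zero (hθ k) z]
    push_cast; ring
  have hkσ : ∀ k, (⌊phiForm (permS σ (ζ - θ)) k⌋ : ℝ) = phiForm (permS σ ζ) k - 1 - ⌊phiForm (permS σ θ) k⌋ := by
    intro k
    obtain ⟨z, hz⟩ := hζσ k
    rw [hperm, hsub, hz, floor_int_sub_of_fract_ne_zero (hθσ k) z]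
    push_cast; ring
  have hinv := sum_FIdx_phiForm_permS σ ζ
  have e1 : ((torusTerm (ζ - θ) σ : ℤ) : ℝ) = ∑ i ∈ FIdx, ((phiForm ζ i - 1 - ⌊phiForm θ i⌋) -
      (phiForm (permS σ ζ) i - 1 - ⌊phiForm (permS σ θ) i⌋)) := by
    unfold torusTerm; push_cast
    exact Finset.sum_congr rfl fun i _ => by rw [hk, hkσ]
  have e2 : ((torusTerm θ σ : ℤ) : ℝ) = ∑ i ∈ FIdx, ((⌊phiForm θ i⌋ : ℝ) - ⌊phiForm (permS σ θ) i⌋) := by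
    unfold torusTerm; push_cast; rfl
  have : ((torusTerm (ζ - θ) σ : ℤ) : ℝ) = -torusTerm θ σ := by
    rw [e1, e2]
    simp only [Finset.sum_sub_distrib]
    linarith [hinv]
  exact_mod_cast this

/-- **`𝒩(ζ − θ) = −min_σ torusTerm θ σ`** under the same hypotheses. -/
theorem torusN_intVec_sub {θ ζ : Fin 8 → ℝ} (hζ : ∀ k, ∃ z : ℤ, phiForm ζ k = z)
    (hθ : ∀ k, Int.fract (phiForm θ k) ≠ 0) :
    torusN (ζ - θ) = -(Finset.univ.inf' Finset.univ_nonempty (torusTerm θ)) := by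
  unfold torusN
  apply le_antisymm
  · refine Finset.sup'_le _ _ fun σ _ => ?_
    rw [torusTerm_intVec_sub hζ hθ σ, neg_le_neg_iff]
    exact Finset.inf'_le _ (Finset.mem_univ σ)
  · obtain ⟨σ₀, _, h0⟩ := Finset.exists_mem_eq_inf' Finset.univ_nonempty (torusTerm θ)
    rw [h0, ← torusTerm_intVec_sub hζ hθ σ₀]
    exact Finset.le_sup' _ (Finset.mem_univ σ₀)

/-- **REFLECTION OF THE ORBIT**: for `a` in the closed box with INTEGER forms and `u` off the walls,
`N_a(1 − u) = −min_σ torusTerm (u·s(a)) σ`. -/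
theorem savingN_one_sub {a : Dir} (ha : BZBox a) (hint : ∀ k, ∃ z : ℤ, h28 a k = z) {u : ℝ}
    (hu : ∀ k, Int.fract (u * h28 a k) ≠ 0) :
    savingN a (1 - u) = -(Finset.univ.inf' Finset.univ_nonempty (torusTerm (u • sParam a))) := by
  rw [savingN_eq_torusN_of_BZBox ha, sub_smul, one_smul]
  refine torusN_intVec_sub (fun k => ?_) (fun k => ?_)
  · obtain ⟨z, hz⟩ := hint k
    refine ⟨z, ?_⟩
    have := phiForm_smul_sParam 1 a k
    rw [one_smul] at this
    rw [this, one_mul, hz]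
  · rw [phiForm_smul_sParam]; exact hu k

end Summit.KontsevichZagierPeriods.Zeta5Search.Barrier.ConeGamma

end
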